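import Summits.QuantumFields.BalabanUV.Beta.CovariantTowerMatrix
import Summits.QuantumFields.BalabanUV.Beta.MultiscaleParametrix

/-!
# Beta / MultiscaleParametrixWRS — BRICK (d) OF THE (w4-d)-FLAT PROGRAMME: THE PARAMETRIX OF THE MULTI-REGION MODEL OPERATOR IN THE
# (2.16)∕WRS CURRENCY — the ROW-WISE fixed point `wrs(A⁻¹)(p) ≤ wrs(G′₀)(p)∕(1 − ρ)`, `1 − R′` a unit by the sup-contraction,
# `A⁻¹ = G′₀(1 − R′)⁻¹`, `WRS((1 − R′)⁻¹) ≤ (1 − ρ)⁻¹`, and the overlap bookkeeping `ρ = ν_K·C_K` from PER-BOX row bounds (MODEL;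
# abstract in the bump family; any site∕bond structure; any pseudo-metric weight)

Node (w4-c) (`MultiscaleParametrix.parametrix_levelOp`, gen 9) inverted `1 − R′` in the ℓ² resolvent currency.  NODE A of row D4 and
print's random-walk expansion live in the (2.16) currency of exponentially weighted row sums (`B13PerturbativeStep.WRS κ d`), where a bound
on `R′` must be UNIFORM over rows while the bound on `G′₀` carries the squared LOCAL scale `n(p)²` of the row.  This module is the
currency-free algebra of that situation, for real endomorphisms `Module.End ℝ (Y → ℝ)` read as matrices through this lineage's `cmat`:
* §1 `wrs_cmat_sum_le`, `wrs_cmat_eq_zero_of_row`, **`wrs_cmat_sum_le_of_overlap`** — rows of a sum of box terms each vanishing off its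
  box's row set and bounded by `f` on it, at most `ν` row sets through a row ⟹ `wrs(Σ_z T_z)(p) ≤ ν·f`;
* §2 **`eq_zero_of_apply_eq`** (a `WRS`-contraction has no fixed vector, sup-norm argument), **`isUnit_one_sub_of_wrs`** (`1 − R` is a
  unit of `Module.End` — `LinearMap.isUnit_iff_ker_eq_bot`), **`wrs_ringInverse_one_sub`** (`WRS (cmat (1 − R)⁻¹) (1 − ρ)⁻¹` —
  an4's `WRS.inv_one_sub` BY NAME through `cmat_ringInverse`), **`wrs_le_of_fixedPoint`** (`B = G₀ + B·R`, `WRS (cmat R) ρ`, `ρ < 1`,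
  `wrs(G₀)(p) ≤ g` ⟹ `wrs(B)(p) ≤ g∕(1 − ρ)` — ROW BY ROW, so a row-dependent `g` (print's `(L^jη)²`) passes through);
* §3 **`parametrix_wrs`** — `A` a unit, `A·G₀ = 1 − R` ⟹ the four conclusions above for `A⁻¹ = Ring.inverse A` (pv21 `fixedPoint_of_388`);
* §4 **`parametrix_levelOp_wrs`** — for pv21's `levelOp` on general hulls (`MultiscaleParametrix.eq388_levelOp`: `A·G′₀ = 1 − R′`,
  `G′₀ = Σ_z h_zG′_zh_z`, `R′ = Σ_z K(h_z)G′_zh_z`) with PER-BOX data: a row set `Kset z` carrying the rows of the remainder term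
  `S_z = K(h_z)G′_zM_{h_z}` with `wrs(S_z)(p) ≤ C_K` on it and `≤ ν_K` such sets through a site, `wrs(h_zG′_zh_z)(p) ≤ g(p)` on `supp h_z`
  with `≤ ν` supports through a site, `ν_K·C_K < 1` ⟹ `1 − R′` unit, `A⁻¹ = G′₀(1 − R′)⁻¹`, `WRS((1 − R′)⁻¹) ≤ (1 − ν_KC_K)⁻¹`,
  **`wrs_{κ,d}(A⁻¹)(p) ≤ ν·g(p)∕(1 − ν_KC_K)`** — the (3.89)∕Thm 3.7 «M sufficiently large» SHAPE in the WRS currency, level-free exactly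
  when `C_K` is (brick (c), `MultiscaleRemainderWRS`, supplies `C_K = O(1∕M)` for the flat MODEL)
(unit `b2b-balaban-beta-d4-p2`, GEN 12, MODEL crew; claim «WRS-PARAMETRIX-FLAT» journal l.25540; O.2 skeleton v1.7.1 §8.12 (w4-d)).

HONEST FRAMING: discharging `BetaPertH` makes Bałaban's UV stability UNCONDITIONAL — NOT the continuum limit, NOT the
Clay problem.  HONEST DEPENDENCY (verbatim): «continuum YM on T⁴ ⇐ BetaPertH ∧ nine spine estimates (0/9 proved);
BetaPertH ⇐ (D1) ∧ (D4) ∧ CAP+tail; G-an2-4 gates asym, D1 and NE2/3/4.»  THIS MODULE DISCHARGES NOTHING of `BetaPertH`,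
asserts NOTHING printed and cites nothing as a fact (ABSOLUTE RULE): [folklore] finite-dimensional linear algebra about the pv21 component
MODEL; the per-box bounds, row sets and counts are DATA.  LOCI (shape only): [B9] = `Balaban1985BackgroundPropagators` (3.87)–(3.91)
pp. 408–409, Thm 3.7; [B6] = `Balaban1984PropagatorsII` (2.37)–(2.40) pp. 229–230; [II] = `Balaban1988RG2Cluster` (2.16) p. 15.  No
random-walk INDEXING here (node (w4-f)); no class change on row D4 (critical-path width 0; D4 DISCHARGE NO DATE); NOT BetaPertH, NOT
continuum, NOT Clay, NOT summit progress.
-/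

namespace Summit.QuantumFields.BalabanUV.Beta.MultiscaleParametrixWRS

open Finset
open Literature.MathematicalPhysics.QuantumFieldTheory.Balaban1983to89
open B9Thm37Sum (mulOp mulOp_apply fixedPoint_of_388)
open B9Thm37Glue (IsTransposePair)
open B9Thm37GlueTorusInv (isUnit_of_posDef dirInv)
open B9Thm37GlueTorusCovLevels (levelOp levelSum)
open B13PerturbativeStep (WRS wrs WeightHyp wrs_nonneg wrs_add_le wrs_mul_le rowSum_le_wrs)
open Summit.QuantumFields.BalabanUV.Beta.CovariantTowerMatrix
open Summit.QuantumFields.BalabanUV.Beta.MultiscaleRemainderLeibniz (remK)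
open Summit.QuantumFields.BalabanUV.Beta.MultiscaleParametrix (G0sum Rsum eq388_levelOp)

noncomputable section

/-! ## §1 Rows of sums of box terms -/

section Rows

variable {Y : Type} [Fintype Y] [DecidableEq Y] {κ : ℝ} {dY : Y → Y → ℝ}

/-- The weighted row sum of (the matrix of) a finite sum of endomorphisms is at most the sum of the weighted row sums. [folklore] -/
theorem wrs_cmat_sum_le {ι : Type} [DecidableEq ι] (s : Finset ι) (T : ι → Module.End ℝ (Y → ℝ)) (p : Y) :
    wrs κ dY (cmat (∑ z ∈ s, T z)) p ≤ ∑ z ∈ s, wrs κ dY (cmat (T z)) p := by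
  induction s using Finset.induction_on with
  | empty =>
      rw [Finset.sum_empty, Finset.sum_empty, cmat_zero]
      unfold wrs
      simp
  | insert a s ha ih =>
      rw [Finset.sum_insert ha, Finset.sum_insert ha, cmat_add]
      exact (wrs_add_le _ _ _).trans (add_le_add le_rfl ih)

/-- A row all of whose entries vanish has weighted row sum `0`. [folklore] -/
theorem wrs_cmat_eq_zero_of_row (T : Module.End ℝ (Y → ℝ)) (p : Y) (h : ∀ q, T (Pi.single q 1) p = 0) :
    wrs κ dY (cmat T) p = 0 := by
  rw [wrs_cmat_eq]
  exact Finset.sum_eq_zero fun q _ => by rw [h q, abs_zero, zero_mul]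

/-- **ROWS OF A SUM OF BOX TERMS BY OVERLAP**: if the row `p` of `T_z` vanishes unless `p` lies in the row set `W z`, is bounded by `f ≥ 0`
when it does, and at most `ν` row sets contain `p`, then `wrs(Σ_z T_z)(p) ≤ ν·f`.  (The WRS-currency form of the (3.89) overlap count;
this lineage's gen-4 `l2Bound_sum_of_overlap` is the ℓ² form.) [cite: Balaban1985BackgroundPropagators, (3.89) p.409] [folklore] -/
theorem wrs_cmat_sum_le_of_overlap {ι : Type} [Fintype ι] [DecidableEq ι] (T : ι → Module.End ℝ (Y → ℝ)) (W : ι → Y → Prop)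
    [∀ z, DecidablePred (W z)] (p : Y) {f : ℝ} (hf : 0 ≤ f)
    (hzero : ∀ z, ¬ W z p → ∀ q, T z (Pi.single q 1) p = 0)
    (hrow : ∀ z, W z p → wrs κ dY (cmat (T z)) p ≤ f)
    {ν : ℝ} (hν : ((univ.filter fun z => W z p).card : ℝ) ≤ ν) :
    wrs κ dY (cmat (∑ z, T z)) p ≤ ν * f := by
  calc wrs κ dY (cmat (∑ z, T z)) p ≤ ∑ z, wrs κ dY (cmat (T z)) p := wrs_cmat_sum_le _ _ _
    _ ≤ ∑ z, (if W z p then f else 0) := Finset.sum_le_sum fun z _ => by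
        by_cases hz : W z p
        · rw [if_pos hz]; exact hrow z hz
        · rw [if_neg hz, wrs_cmat_eq_zero_of_row _ _ (hzero z hz)]
    _ = ((univ.filter fun z => W z p).card : ℝ) * f := by
        rw [Finset.sum_ite, Finset.sum_const_zero, add_zero, Finset.sum_const, nsmul_eq_mul]
    _ ≤ ν * f := mul_le_mul_of_nonneg_right hν hf

end Rows

/-! ## §2 The sup-contraction, the unit `1 − R`, and the row-wise fixed point -/

section Neumann

variable {Y : Type} [Fintype Y] [DecidableEq Y] {κ : ℝ} {dY : Y → Y → ℝ}

/-- **A `WRS`-contraction has no fixed vector**: `WRS κ d (cmat R) ρ`, `ρ < 1`, `R v = v` ⟹ `v = 0` (sup-norm argument at a coordinate of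
maximal modulus; the weights are `≥ 1`).  The `Module.End` form of an4's `B13PerturbativeStep.eq_zero_of_mulVec_eq`. [folklore] -/
theorem eq_zero_of_apply_eq (hw : WeightHyp κ dY) {R : Module.End ℝ (Y → ℝ)} {ρ : ℝ} (hR : WRS κ dY (cmat R) ρ) (hρ : ρ < 1)
    {v : Y → ℝ} (hv : R v = v) : v = 0 := by
  rcases isEmpty_or_nonempty Y with hY | hY
  · funext p; exact (IsEmpty.false p).elim
  obtain ⟨p₀, hp₀⟩ := Finite.exists_max fun p => |v p|
  have hm : |v p₀| ≤ ρ * |v p₀| := by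
    calc |v p₀| = |R v p₀| := by rw [hv]
      _ = |∑ q, R (Pi.single q 1) p₀ * v q| := by rw [apply_eq_sum_single R v p₀]
      _ ≤ ∑ q, |R (Pi.single q 1) p₀ * v q| := Finset.abs_sum_le_sum_abs _ _
      _ = ∑ q, |R (Pi.single q 1) p₀| * |v q| := Finset.sum_congr rfl fun q _ => abs_mul _ _
      _ ≤ ∑ q, |R (Pi.single q 1) p₀| * |v p₀| :=
          Finset.sum_le_sum fun q _ => mul_le_mul_of_nonneg_left (hp₀ q) (abs_nonneg _)
      _ = (∑ q, ‖cmat R p₀ q‖) * |v p₀| := by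
          rw [Finset.sum_mul]
          exact Finset.sum_congr rfl fun q _ => by rw [norm_cmat_apply]
      _ ≤ wrs κ dY (cmat R) p₀ * |v p₀| := mul_le_mul_of_nonneg_right (rowSum_le_wrs hw _ _) (abs_nonneg _)
      _ ≤ ρ * |v p₀| := mul_le_mul_of_nonneg_right (hR p₀) (abs_nonneg _)
  have hm0 : |v p₀| = 0 := by nlinarith [abs_nonneg (v p₀)]
  funext p
  have h := hp₀ p
  rw [hm0] at h
  exact abs_eq_zero.mp (le_antisymm h (abs_nonneg _))

/-- **`1 − R` is a unit of `Module.End`** when `WRS κ d (cmat R) ρ` with `ρ < 1`: trivial kernel (§2) on a finite-dimensional space.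
[cite: Balaban1985BackgroundPropagators, Thm 3.7 p.409] [folklore] -/
theorem isUnit_one_sub_of_wrs (hw : WeightHyp κ dY) {R : Module.End ℝ (Y → ℝ)} {ρ : ℝ} (hR : WRS κ dY (cmat R) ρ) (hρ : ρ < 1) :
    IsUnit (1 - R) := by
  rw [LinearMap.isUnit_iff_ker_eq_bot, LinearMap.ker_eq_bot']
  intro v hv
  have hv' : R v = v := by
    rw [LinearMap.sub_apply, Module.End.one_apply, sub_eq_zero] at hv
    exact hv.symm
  exact eq_zero_of_apply_eq hw hR hρ hv'

/-- **`WRS (cmat (1 − R)⁻¹) (1 − ρ)⁻¹`** — an4's Neumann bound `WRS.inv_one_sub` BY NAME, transported to `Ring.inverse` in `Module.End`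
through `cmat_ringInverse`. [cite: Balaban1988RG2Cluster, (2.16) p.15] [folklore] -/
theorem wrs_ringInverse_one_sub (hw : WeightHyp κ dY) {R : Module.End ℝ (Y → ℝ)} {ρ : ℝ} (hR : WRS κ dY (cmat R) ρ) (hρ : ρ < 1) :
    WRS κ dY (cmat (Ring.inverse (1 - R))) (1 - ρ)⁻¹ := by
  rw [cmat_ringInverse (isUnit_one_sub_of_wrs hw hR hρ), cmat_sub, cmat_one]
  exact B13PerturbativeStep.WRS.inv_one_sub hw hR hρ

/-- **THE ROW-WISE FIXED POINT**: `B = G₀ + B·R`, `WRS κ d (cmat R) ρ`, `ρ < 1`, `wrs(cmat G₀)(p) ≤ g` ⟹ `wrs(cmat B)(p) ≤ g∕(1 − ρ)` — one row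
at a time (`wrs(B·R)(p) ≤ wrs(B)(p)·ρ` by the triangle inequality of the weight), so a ROW-DEPENDENT bound on the local part passes to
the inverse.  The WRS reading of «G′ = G′₀Σ_n R′ⁿ». [cite: Balaban1985BackgroundPropagators, (3.90)–(3.91) p.409] [folklore] -/
theorem wrs_le_of_fixedPoint (hw : WeightHyp κ dY) {B G₀ R : Module.End ℝ (Y → ℝ)} (hfix : B = G₀ + B * R)
    {ρ : ℝ} (hR : WRS κ dY (cmat R) ρ) (hρ : ρ < 1) (p : Y) {g : ℝ} (hg : wrs κ dY (cmat G₀) p ≤ g) :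
    wrs κ dY (cmat B) p ≤ g / (1 - ρ) := by
  have h1 : wrs κ dY (cmat B) p ≤ g + wrs κ dY (cmat B) p * ρ := by
    calc wrs κ dY (cmat B) p = wrs κ dY (cmat G₀ + cmat B * cmat R) p := by rw [← cmat_mul, ← cmat_add, ← hfix]
      _ ≤ wrs κ dY (cmat G₀) p + wrs κ dY (cmat B * cmat R) p := wrs_add_le _ _ _
      _ ≤ g + ∑ l, ‖cmat B p l‖ * Real.exp (κ * dY p l) * wrs κ dY (cmat R) l := add_le_add hg (wrs_mul_le hw _ _ _)
      _ ≤ g + ∑ l, ‖cmat B p l‖ * Real.exp (κ * dY p l) * ρ :=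
          add_le_add le_rfl (Finset.sum_le_sum fun l _ => mul_le_mul_of_nonneg_left (hR l) (by positivity))
      _ = g + wrs κ dY (cmat B) p * ρ := by unfold wrs; rw [Finset.sum_mul]
  rw [le_div_iff₀ (sub_pos.mpr hρ)]
  nlinarith [wrs_nonneg (κ := κ) (d := dY) (cmat B) p]

/-! ## §3 The parametrix in the WRS currency, abstract form -/

/-- **THE PARAMETRIX IN THE (2.16)∕WRS CURRENCY (abstract)**: `A` a unit with `A·G₀ = 1 − R`, `WRS κ d (cmat R) ρ`, `ρ < 1`, and row bounds
`wrs(cmat G₀)(p) ≤ g(p)` ⟹ `1 − R` is a unit, `A⁻¹ = G₀·(1 − R)⁻¹`, `WRS (cmat (1 − R)⁻¹) (1 − ρ)⁻¹`, and **`wrs(cmat A⁻¹)(p) ≤ g(p)∕(1 − ρ)` for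
every row** (pv21 `fixedPoint_of_388` + §2). [cite: Balaban1985BackgroundPropagators, (3.87)–(3.91) pp.408–409 + Thm 3.7; Balaban1984PropagatorsII, (2.37)–(2.38) p.229] [folklore] -/
theorem parametrix_wrs (hw : WeightHyp κ dY) {A G₀ R : Module.End ℝ (Y → ℝ)} (hA : IsUnit A) (h388 : A * G₀ = 1 - R)
    {ρ : ℝ} (hR : WRS κ dY (cmat R) ρ) (hρ : ρ < 1) (g : Y → ℝ) (hg : ∀ p, wrs κ dY (cmat G₀) p ≤ g p) :
    IsUnit (1 - R) ∧ Ring.inverse A = G₀ * Ring.inverse (1 - R) ∧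
      WRS κ dY (cmat (Ring.inverse (1 - R))) (1 - ρ)⁻¹ ∧ ∀ p, wrs κ dY (cmat (Ring.inverse A)) p ≤ g p / (1 - ρ) := by
  have hU := isUnit_one_sub_of_wrs hw hR hρ
  have hinv : Ring.inverse A * A = 1 := Ring.inverse_mul_cancel _ hA
  have hfix : Ring.inverse A = G₀ + Ring.inverse A * R := fixedPoint_of_388 hinv h388
  have hmul : Ring.inverse A * (1 - R) = G₀ := by
    rw [mul_sub, mul_one]
    exact sub_eq_of_eq_add hfix
  have hG : Ring.inverse A = G₀ * Ring.inverse (1 - R) := by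
    calc Ring.inverse A = Ring.inverse A * ((1 - R) * Ring.inverse (1 - R)) := by
          rw [Ring.mul_inverse_cancel _ hU, mul_one]
      _ = G₀ * Ring.inverse (1 - R) := by rw [← mul_assoc, hmul]
  exact ⟨hU, hG, wrs_ringInverse_one_sub hw hR hρ, fun p => wrs_le_of_fixedPoint hw hfix hR hρ p (hg p)⟩

end Neumann

/-! ## §4 THE END for `levelOp` on general hulls with per-box data -/

section LevelOp

variable {St Bd Cp J B ι : Type} [Fintype St] [DecidableEq St] [Fintype Bd] [Fintype Cp] [DecidableEq Cp]
  [Fintype J] [Fintype B] [DecidableEq B] [Fintype ι] [DecidableEq ι]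
  (src tgt : Bd → St) (c : Bd → ℝ) (Rm : Bd → Cp → Cp → ℝ)
  (blk : J → St → B) (W : J → St → ℝ) (T : J → St → Cp → Cp → ℝ)

omit [Fintype St] [DecidableEq St] [Fintype Bd] [Fintype Cp] [Fintype J] [Fintype B] [DecidableEq B] [Fintype ι] [DecidableEq ι]
  [DecidableEq Cp] in
/-- Rows of a local term `M_h·X·M_h′` vanish off `supp h`. [folklore] -/
theorem mulOp_mul_apply_single_eq_zero (h : St → ℝ) (X : Module.End ℝ (St × Cp → ℝ)) (p : St × Cp) (hp : h p.1 = 0)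
    (u : St × Cp → ℝ) : (mulOp (h ∘ Prod.fst) * X : Module.End ℝ (St × Cp → ℝ)) u p = 0 := by
  rw [Module.End.mul_apply, mulOp_apply, Function.comp_apply, hp, zero_mul]

omit [Fintype B] in
/-- **THE PARAMETRIX OF `levelOp` IN THE (2.16)∕WRS CURRENCY WITH PER-BOX DATA (MODEL; Thm 3.7 ∕ (2.38) SHAPE).**  Bumps `h_z` with
`Σ_z h_z² = 1`, {0,1}-hulls with the clauses (a) `hsite`∕`hbond`, (b) `hχb` of `MultiscaleParametrix.eq388_levelOp`; a pseudo-metric weight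
`(κ, d)` on sites × components; PER BOX: a row set `Kset z` such that the rows of `S_z = K(h_z)G′_zM_{h_z}` vanish off `Kset z` and have
`wrs ≤ C_K` on it, at most `ν_K` such sets through a site; `wrs(h_zG′_zh_z)(p) ≤ g(p)` on `supp h_z`, at most `ν` supports through a site;
`ν_K·C_K < 1`.  THEN `1 − R′` is a unit, `A⁻¹ = G′₀(1 − R′)⁻¹`, `WRS (cmat (1 − R′)⁻¹) (1 − ν_KC_K)⁻¹`, `WRS (cmat R′) (ν_KC_K)`, and
**`wrs_{κ,d}(cmat A⁻¹)(p) ≤ ν·g(p)∕(1 − ν_KC_K)`** for every row `p`.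
[cite: Balaban1985BackgroundPropagators, (3.87)–(3.91) pp.408–409 + Thm 3.7; Balaban1984PropagatorsII, (2.36)–(2.38) p.229; Balaban1988RG2Cluster, (2.16) p.15] [folklore] -/
theorem parametrix_levelOp_wrs (a : J → ℝ)
    (hA : ∀ f : St × Cp → ℝ, f ≠ 0 → 0 < ∑ p, f p * levelOp src tgt c Rm blk W T a f p)
    (hs : ι → St → ℝ) (hsq : ∀ x, ∑ z, hs z x ^ 2 = 1) (χ : ι → St → ℝ) (hχ : ∀ z x, χ z x = 0 ∨ χ z x = 1)
    (hsite : ∀ z x, hs z x ≠ 0 → χ z x = 1)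
    (hbond : ∀ z b, (hs z (src b) ≠ 0 ∨ hs z (tgt b) ≠ 0) → χ z (src b) = 1 ∧ χ z (tgt b) = 1)
    (χb : ι → J → B → ℝ) (hχb : ∀ z j x, W j x ≠ 0 → χ z x = χb z j (blk j x))
    {κ : ℝ} {dY : St × Cp → St × Cp → ℝ} (hw : WeightHyp κ dY)
    (Kset : ι → St → Prop) [∀ z, DecidablePred (Kset z)]
    (hKrow : ∀ (z) (p : St × Cp), ¬ Kset z p.1 → ∀ q, (remK src tgt c Rm (levelSum blk W T a) (hs z) *
      dirInv (levelOp src tgt c Rm blk W T a) (χ z ∘ Prod.fst) * mulOp (hs z ∘ Prod.fst) :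
        Module.End ℝ (St × Cp → ℝ)) (Pi.single q 1) p = 0)
    {CK : ℝ} (hCK : 0 ≤ CK)
    (hKwrs : ∀ z p, Kset z p.1 → wrs κ dY (cmat (remK src tgt c Rm (levelSum blk W T a) (hs z) *
      dirInv (levelOp src tgt c Rm blk W T a) (χ z ∘ Prod.fst) * mulOp (hs z ∘ Prod.fst))) p ≤ CK)
    {νK : ℝ} (hνK : ∀ x, ((univ.filter fun z => Kset z x).card : ℝ) ≤ νK)
    (g : St × Cp → ℝ) (hg0 : ∀ p, 0 ≤ g p)
    (hPwrs : ∀ z p, hs z p.1 ≠ 0 → wrs κ dY (cmat (mulOp (hs z ∘ Prod.fst) *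
      dirInv (levelOp src tgt c Rm blk W T a) (χ z ∘ Prod.fst) * mulOp (hs z ∘ Prod.fst))) p ≤ g p)
    {ν : ℝ} (hν : ∀ x, ((univ.filter fun z => hs z x ≠ 0).card : ℝ) ≤ ν) (hsmall : νK * CK < 1) :
    IsUnit (1 - Rsum src tgt c Rm (levelSum blk W T a) (levelOp src tgt c Rm blk W T a) hs χ) ∧
      Ring.inverse (levelOp src tgt c Rm blk W T a) =
        G0sum (levelOp src tgt c Rm blk W T a) hs χ *
          Ring.inverse (1 - Rsum src tgt c Rm (levelSum blk W T a) (levelOp src tgt c Rm blk W T a) hs χ) ∧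
      WRS κ dY (cmat (Ring.inverse (1 - Rsum src tgt c Rm (levelSum blk W T a) (levelOp src tgt c Rm blk W T a) hs χ)))
        (1 - νK * CK)⁻¹ ∧
      WRS κ dY (cmat (Rsum src tgt c Rm (levelSum blk W T a) (levelOp src tgt c Rm blk W T a) hs χ)) (νK * CK) ∧
      ∀ p, wrs κ dY (cmat (Ring.inverse (levelOp src tgt c Rm blk W T a))) p ≤ ν * g p / (1 - νK * CK) := by
  set A := levelOp src tgt c Rm blk W T a with hAdef
  set R := Rsum src tgt c Rm (levelSum blk W T a) A hs χ with hRdef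
  set G0 := G0sum A hs χ with hG0
  -- the remainder: uniform rows by overlap of the K-sets
  have hR : WRS κ dY (cmat R) (νK * CK) := by
    intro p
    rw [hRdef, Rsum]
    exact wrs_cmat_sum_le_of_overlap _ (fun z (q : St × Cp) => Kset z q.1) p hCK (fun z hz => hKrow z p hz)
      (fun z hz => hKwrs z p hz) (hνK p.1)
  -- the local part: row-dependent rows by overlap of the supports
  have hG0rows : ∀ p, wrs κ dY (cmat G0) p ≤ ν * g p := by
    intro p
    rw [hG0, G0sum]
    refine wrs_cmat_sum_le_of_overlap _ (fun z (q : St × Cp) => hs z q.1 ≠ 0) p (hg0 p) (fun z hz q => ?_)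
      (fun z hz => hPwrs z p hz) (hν p.1)
    rw [mul_assoc]
    exact mulOp_mul_apply_single_eq_zero (hs z) _ p (not_not.mp hz) _
  have h388 : A * G0 = 1 - R := eq388_levelOp src tgt c Rm blk W T a hA hs hsq χ hχ hsite hbond χb hχb
  obtain ⟨hU, hG, hWinv, hrows⟩ := parametrix_wrs hw (isUnit_of_posDef hA) h388 hR hsmall (fun p => ν * g p) hG0rows
  exact ⟨hU, hG, hWinv, hR, fun p => hrows p⟩

end LevelOp

end

end Summit.QuantumFields.BalabanUV.Beta.MultiscaleParametrixWRS
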